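import Summits.AtomisticToContinuum.FouriersLaw.Theorems.BondHeatUncertaintyExtensiveSnapshotIrreversibilityEnergyWindowOddMomentB
import Summits.AtomisticToContinuum.FouriersLaw.Theorems.BondHeatUncertaintyExtensiveSnapshotIrreversibilityEnergyWindowHarrisResponse

/-!
# Crux `ExtensiveSnapshotIrreversibility` (stmt-AtomisticToContinuum-9121), fixed-`N` half `K_fix`:
the `Lᵖ`-GRADED odd log-ratio atom `A2ₚ` and the glue `A0 → A1 → A2ₚ → A3 → A4 → K_fix`
(node «OddLogRatioMomentLadder», part 2/3)

(helper file, theorem-side; decomp-a2c lens-1 «grading / quantitative ladder», generation 88.)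

The junction of record for `K_fix = SnapshotKLUpperExpansion` is
`K_fix ⟸ A0 ∧ A2 ∧ S3 ∧ A3p ∧ A4` (`snapshotKLUpperExpansion_of_atoms₅K`, `…HarrisResponse`), with
A1 `NessExpMomentBound` PROVED (`nessExpMomentBound_holds`) and A2 `NessOddLogRatioBound` — the
`δ`-UNIFORM POINTWISE bound `|φ_δ − φ_δ∘Θ| ≤ C₂(1 + H)^k` a.e. — open and idea-level (a Harnack
chain for the hypoelliptic stationary equation).  This file GRADES A2 by the integrability exponent
of the odd log-density `ψ_δ := φ_δ − φ_δ∘Θ` under the steady state ITSELF: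

* `NessOddLogRatioMoment p` (A2ₚ) — for `0 < |δ| < δ₀` and every measurable reweighting exponent
  `φ` (`μ_{N,T+δ/2,T−δ/2} = μ_T · e^{φ}`): `|φ − φ∘Θ|ᵖ ∈ L¹(μ_{N,T+δ/2,T−δ/2})` and
  `∫ |φ − φ∘Θ|ᵖ dμ_{N,T+δ/2,T−δ/2} ≤ C |δ|^{−r}` — ONE exponent `p`, ANY polynomial blow-up `r`,
  constants free.  No uniformity in `x`, no smoothness, no Harnack chain: an `Lᵖ` bound of the
  log-likelihood ratio `log(dμ_δ/dΘ_*μ_δ)` under `μ_δ`.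
* ★ `snapshotKLUpperExpansion_of_atoms_moment` — for EVERY `p > 1`:
  `A0 → A1 → A2ₚ → A3 → A4 → K_fix` (the moment seam `klDiv_flip_le_of_energyWindow_moment` of part
  1b, specialised to `μ₀ = μ_T`, `W = H` exactly as `snapshotKLUpperExpansion_of_energyWindow`; the
  atoms are fed to the seam DIRECTLY — its floor hypothesis is almost-everywhere, so no
  flip-symmetrisation of good sets is needed).
* ★ `snapshotKLUpperExpansion_of_atoms_moment₅K` — the junction of record with A2 replaced by A2ₚ:
  `K_fix ⟸ A0 ∧ A2ₚ ∧ S3 ∧ A3p ∧ A4` (A1 discharged by `nessExpMomentBound_holds`, A3 by the landed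
  seam `A3 ⟸ A3i ⟸ S3`, `A3p`).

The LADDER in `p` (A2 = `p = ∞` ⟹ A2ₚ for all `p`; A2ₚ antitone in `p`; `p = 1` signed ≡ `K_fix`) is
part 3 (`…EnergyWindowOddMomentLadder`).  No new objects. [folklore: Young/Hölder tail]
References: as in `…EnergyWindowTree`; for `Lᵖ` bounds on log-likelihood ratios of stationary
densities of degenerate diffusions cf. V. I. Bogachev, N. V. Krylov, M. Röckner, S. V. Shaposhnikov,
*Fokker–Planck–Kolmogorov equations*, AMS Surveys 207 (2015), Ch. 3 (integrability of `|∇ log ρ|`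
and of `log ρ` against `ρ`).
-/

noncomputable section

namespace Summit.AtomisticToContinuum.FouriersLaw.Theorems.ExtensiveSnapshotIrreversibility.EnergyWindow

open MeasureTheory Filter Topology InformationTheory Real
open scoped ENNReal NNReal
open Literature.MathematicalPhysics.KineticTheory.HeatConduction
open Summit.AtomisticToContinuum.FouriersLaw.Theorems.ExtensiveSnapshotIrreversibility.Negative
open Summit.AtomisticToContinuum.FouriersLaw.Theorems.ExtensiveSnapshotIrreversibility.ClausiusBudget.OddLogDensity

variable {N : ℕ}

/-! ## 1. The graded atom `A2ₚ` -/

/-- **A2ₚ `NessOddLogRatioMoment p` (the `Lᵖ` grade of clause (T2o))**: along every steady-state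
family of the pinned chain (under weak-NESS uniqueness), for `T > 0`, `N ≥ 2`, there are `δ₀ > 0` and
constants `C`, `r` such that for `0 < |δ| < δ₀` and EVERY measurable `φ` with
`μ_{N,T+δ/2,T−δ/2} = μ_T · e^{φ}`: the odd log-density `φ − φ∘Θ` has FINITE `p`-TH MOMENT under the
steady state, `∫ |φ(x) − φ(Θx)|ᵖ dμ_{N,T+δ/2,T−δ/2}(x) ≤ C |δ|^{−r}` (a polynomial blow-up in `δ` is
allowed; for `p > 1` any such bound feeds `K_fix`, `snapshotKLUpperExpansion_of_atoms_moment`).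
[route statement · this cell; NOT a literature fact] -/
def NessOddLogRatioMoment (p : ℝ) : Prop :=
  ∀ ω₂ lam β γ : ℝ, 0 < ω₂ → 0 < lam → 0 < β → 0 < γ →
    (∀ (N : ℕ) (T_L T_R : ℝ), 0 < T_L → 0 < T_R → ∀ μ ν : Measure (PhaseSpace N),
      (pinnedChain ω₂ lam β γ).IsSteadyState N T_L T_R μ →
      (pinnedChain ω₂ lam β γ).IsSteadyState N T_L T_R ν → μ = ν) →
    ∀ μ : (N : ℕ) → ℝ → ℝ → Measure (PhaseSpace N),
      (∀ (N : ℕ) (T_L T_R : ℝ), 0 < T_L → 0 < T_R →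
        (pinnedChain ω₂ lam β γ).IsSteadyState N T_L T_R (μ N T_L T_R)) →
      ∀ T : ℝ, 0 < T → ∀ N : ℕ, 2 ≤ N →
        ∃ δ₀ C r : ℝ, 0 < δ₀ ∧
          ∀ δ : ℝ, δ ≠ 0 → |δ| < δ₀ →
            ∀ φ : PhaseSpace N → ℝ, Measurable φ →
              μ N (T + δ / 2) (T - δ / 2) =
                ((pinnedChain ω₂ lam β γ).gibbsMeasure N T).withDensity
                  (fun x => ENNReal.ofReal (Real.exp (φ x))) →
              Integrable (fun x => |φ x - φ (x.1, -x.2)| ^ p) (μ N (T + δ / 2) (T - δ / 2)) ∧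
                ∫ x, |φ x - φ (x.1, -x.2)| ^ p ∂(μ N (T + δ / 2) (T - δ / 2)) ≤ C * |δ| ^ (-r)

/-! ## 2. The glue `A0 → A1 → A2ₚ → A3 → A4 → K_fix` for every `p > 1` -/

/-- ★ **THE GLUE `A0 → A1 → A2ₚ → A3 → A4 → K_fix` (`p > 1`).**  Take the A0 exponents `φ_δ`
(`|δ| < 2T`); `μ_T` is a flip-invariant probability measure (`Negative.gibbsMeasure_map_flip`), the
states are `μ_T.tilted φ_δ` (`tilted_of_withDensity_exp`), so A1 and A2ₚ become the `μ_T`-integral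
clauses (T1), (T2ₚ) of the moment seam, A3 is its almost-everywhere floor clause for every slack
`a > 0`, and A4 (through `dμ_δ/dμ_T = e^{φ_δ}` a.e., `Measure.rnDeriv_withDensity`) gives the odd
quadratic form (`eventually_integral_oddSq_le`); the item's response density `h` equals the
`L²`-derivative `g₀` a.e. (`ae_eq_of_tendsto_testFunction`), so the threshold is the item's.
[folklore] -/
theorem snapshotKLUpperExpansion_of_atoms_moment {p : ℝ} (hp : 1 < p) (h0 : NessGibbsReweighting)
    (h1 : NessExpMomentBound) (h2 : NessOddLogRatioMoment p) (h3 : NessDensityFloor)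
    (h4 : NessLinearResponseL2) : SnapshotKLUpperExpansion := by
  intro ω₂ lam β γ hω₂ hlam hβ hγ hU μ hμ T hT N hN h hh K hK
  obtain ⟨φ, hφm, hW0⟩ := h0 ω₂ lam β γ hω₂ hlam hβ hγ hU μ hμ T hT N hN
  obtain ⟨δ₁, θ, C₁, hδ₁, hθ, hT1⟩ := h1 ω₂ lam β γ hω₂ hlam hβ hγ hU μ hμ T hT N hN
  obtain ⟨δ₂, C₂, r, hδ₂, hT2⟩ := h2 ω₂ lam β γ hω₂ hlam hβ hγ hU μ hμ T hT N hN
  obtain ⟨δ₄, hδ₄, g₀, hg₀, hB2m, hB2t⟩ := h4 ω₂ lam β γ hω₂ hlam hβ hγ hU μ hμ T hT N hN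
  set P := pinnedChain ω₂ lam β γ with hP
  set μT := P.gibbsMeasure N T with hμT
  haveI hprob : IsProbabilityMeasure μT :=
    pinnedChain_isProbabilityMeasure_gibbsMeasure hω₂ hlam.le hβ.le γ N hT
  have hG : μ N T T = μT :=
    hU N T T hT hT _ _ (hμ N T T hT hT) (pinnedChain_isSteadyState_gibbsMeasure hω₂ hlam.le hβ.le γ N hT)
  have hinv : μT.map (fun x : PhaseSpace N => (x.1, -x.2)) = μT := gibbsMeasure_map_flip P N T
  have hmp : MeasurePreserving (momentumReversal N) μT μT := ⟨(momentumReversal N).measurable, hinv⟩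
  have hHm : Measurable (P.hamiltonian N) := (pinnedChain_continuous_hamiltonian ω₂ lam β γ N).measurable
  have hH0 : ∀ x, 0 ≤ P.hamiltonian N x := pinnedChain_hamiltonian_nonneg hω₂.le hlam.le hβ.le γ N
  have hHflip : ∀ x : PhaseSpace N, P.hamiltonian N (x.1, -x.2) = P.hamiltonian N x :=
    P.hamiltonian_neg_momentum N
  have hpq : p.HolderConjugate (conjExponent p) := Real.HolderConjugate.conjExponent hp
  -- the eventual range and the tilted representation of the states
  have h2T : (0 : ℝ) < 2 * T := by positivity
  set δ₀ : ℝ := min (min δ₁ δ₂) (min δ₄ (2 * T)) with hδ₀def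
  have hδ₀ : 0 < δ₀ := lt_min (lt_min hδ₁ hδ₂) (lt_min hδ₄ h2T)
  have hδ₀₁ : δ₀ ≤ δ₁ := (min_le_left _ _).trans (min_le_left _ _)
  have hδ₀₂ : δ₀ ≤ δ₂ := (min_le_left _ _).trans (min_le_right _ _)
  have hδ₀₄ : δ₀ ≤ δ₄ := (min_le_right _ _).trans (min_le_left _ _)
  have hδ₀T : δ₀ ≤ 2 * T := (min_le_right _ _).trans (min_le_right _ _)
  have hev : ∀ᶠ δ in 𝓝[≠] (0 : ℝ), δ ≠ 0 ∧ |δ| < δ₀ := eventually_ne_and_abs_lt hδ₀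
  have hevT : ∀ᶠ δ in 𝓝[≠] (0 : ℝ), 0 < T + δ / 2 ∧ 0 < T - δ / 2 := eventually_bath_temps_pos hT
  have hrep : ∀ δ : ℝ, |δ| < δ₀ → 0 < T + δ / 2 → 0 < T - δ / 2 →
      Integrable (fun x => exp (φ δ x)) μT ∧ ∫ x, exp (φ δ x) ∂μT = 1 ∧
        μ N (T + δ / 2) (T - δ / 2) = μT.tilted (φ δ) := by
    intro δ hδa h1' h2'
    haveI : IsProbabilityMeasure (μ N (T + δ / 2) (T - δ / 2)) := (hμ N _ _ h1' h2').1
    exact tilted_of_withDensity_exp (hφm δ) (hW0 δ (hδa.trans_le hδ₀T))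
  have hZ : ∀ᶠ δ in 𝓝[≠] (0 : ℝ), Integrable (fun x => exp (φ δ x)) μT ∧ ∫ x, exp (φ δ x) ∂μT = 1 := by
    filter_upwards [hev, hevT] with δ hδ hδT
    exact ⟨(hrep δ hδ.2 hδT.1 hδT.2).1, (hrep δ hδ.2 hδT.1 hδT.2).2.1⟩
  -- (T1) from A1
  have hT1' : ∀ᶠ δ in 𝓝[≠] (0 : ℝ),
      Integrable (fun x => exp (θ * P.hamiltonian N x) * exp (φ δ x)) μT ∧
        ∫ x, exp (θ * P.hamiltonian N x) * exp (φ δ x) ∂μT ≤ C₁ := by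
    filter_upwards [hev, hevT] with δ hδ hδT
    obtain ⟨hi, hz1, htilt⟩ := hrep δ hδ.2 hδT.1 hδT.2
    obtain ⟨hI, hle⟩ := hT1 δ hδ.1 (hδ.2.trans_le hδ₀₁)
    rw [htilt] at hI hle
    rw [integrable_tilted_iff hi] at hI
    rw [integral_tilted] at hle
    refine ⟨hI.congr (ae_of_all _ fun x => ?_), ?_⟩
    · simp only [smul_eq_mul]
      ring
    · refine le_trans (le_of_eq (integral_congr_ae (ae_of_all _ fun x => ?_))) hle
      simp only [hz1, div_one, smul_eq_mul]
      ring
  -- (T2ₚ) from A2ₚ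
  have hT2' : ∀ᶠ δ in 𝓝[≠] (0 : ℝ),
      Integrable (fun x => |φ δ x - φ δ (x.1, -x.2)| ^ p * exp (φ δ x)) μT ∧
        ∫ x, |φ δ x - φ δ (x.1, -x.2)| ^ p * exp (φ δ x) ∂μT ≤ C₂ * |δ| ^ (-r) := by
    filter_upwards [hev, hevT] with δ hδ hδT
    obtain ⟨hi, hz1, htilt⟩ := hrep δ hδ.2 hδT.1 hδT.2
    obtain ⟨hI, hle⟩ := hT2 δ hδ.1 (hδ.2.trans_le hδ₀₂) (φ δ) (hφm δ) (hW0 δ (hδ.2.trans_le hδ₀T))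
    rw [htilt] at hI hle
    rw [integrable_tilted_iff hi] at hI
    rw [integral_tilted] at hle
    refine ⟨hI.congr (ae_of_all _ fun x => ?_), ?_⟩
    · simp only [smul_eq_mul]
      ring
    · refine le_trans (le_of_eq (integral_congr_ae (ae_of_all _ fun x => ?_))) hle
      simp only [hz1, div_one, smul_eq_mul]
      ring
  -- (B1w), almost everywhere, for every slack `a > 0`, from A3
  have hB1' : ∀ a : ℝ, 0 < a → ∃ C₃ : ℝ, ∃ m : ℕ, ∀ᶠ δ in 𝓝[≠] (0 : ℝ), ∀ᵐ x ∂μT,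
      1 - C₃ * |δ| * (1 + P.hamiltonian N x) ^ m * exp (a * P.hamiltonian N x) ≤ exp (φ δ x) := by
    intro a ha
    obtain ⟨δ₃, C₃, m, hδ₃, hB1⟩ := h3 ω₂ lam β γ hω₂ hlam hβ hγ hU μ hμ T hT N hN a ha
    refine ⟨C₃, m, ?_⟩
    filter_upwards [eventually_ne_and_abs_lt (lt_min hδ₃ hδ₀)] with δ hδ
    exact hB1 δ hδ.1 (hδ.2.trans_le (min_le_left _ _)) (φ δ) (hφm δ)
      (hW0 δ ((hδ.2.trans_le (min_le_right _ _)).trans_le hδ₀T))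
  -- (B2) from A4: the Radon–Nikodym derivative is `e^{φ δ}` a.e.
  have hrn : ∀ δ : ℝ, |δ| < δ₀ →
      (fun x => ((((μ N (T + δ / 2) (T - δ / 2)).rnDeriv μT) x).toReal - 1) / δ) =ᵐ[μT]
        fun x => (exp (φ δ x) - 1) / δ := by
    intro δ hδ'
    have hmeas : Measurable fun x => ENNReal.ofReal (exp (φ δ x)) := (hφm δ).exp.ennreal_ofReal
    have hd := Measure.rnDeriv_withDensity μT hmeas
    rw [← hW0 δ (hδ'.trans_le hδ₀T)] at hd
    filter_upwards [hd] with x hx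
    rw [hx, ENNReal.toReal_ofReal (exp_pos _).le]
  have hq' : ∀ᶠ δ in 𝓝[≠] (0 : ℝ), MemLp (fun x => (exp (φ δ x) - 1) / δ) 2 μT := by
    filter_upwards [hev] with δ hδ
    exact (memLp_congr_ae (hrn δ hδ.2)).1 (hB2m δ hδ.1 (hδ.2.trans_le hδ₀₄))
  have hlim : Tendsto (fun δ => ∫ x, ((exp (φ δ x) - 1) / δ - g₀ x) ^ 2 ∂μT) (𝓝[≠] (0 : ℝ)) (𝓝 0) := by
    refine hB2t.congr' ?_
    filter_upwards [hev] with δ hδ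
    refine integral_congr_ae ?_
    filter_upwards [hrn δ hδ.2] with x hx
    rw [hx]
  set D : ℝ := ∫ x : PhaseSpace N, (g₀ x - g₀ (x.1, -x.2)) ^ 2 ∂μT with hD
  have hseam := klDiv_flip_le_of_energyWindow_moment μT hinv hHm hH0 hHflip hpq hθ φ hφm hZ hT1' hT2'
    hB1' (D := D) (fun D' hD' => eventually_integral_oddSq_le hinv hg₀ hq' hlim D' hD')
  -- `h = g₀` a.e.: both are weak derivatives on `C_c^∞` tests
  have hae : h =ᵐ[μT] g₀ := by
    have hh1 : Integrable h μT := by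
      have hm2 : MemLp h 2 μT := by
        have := hh.1
        rwa [hG] at this
      exact hm2.integrable one_le_two
    refine ae_eq_of_tendsto_testFunction hh1 (hg₀.integrable one_le_two)
      (Q := fun F δ => ((∫ x, F x ∂(μ N (T + δ / 2) (T - δ / 2))) - ∫ x, F x ∂μT) / δ) ?_ ?_
    · intro F hF hFc
      have h2 := hh.2.1 F hF hFc
      rw [hG] at h2
      exact h2
    · intro F hF hFc
      obtain ⟨B, hB⟩ := hF.continuous.bounded_above_of_compact_support hFc
      have hFm : AEStronglyMeasurable F μT := hF.continuous.aestronglyMeasurable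
      have hFB : ∀ x, |F x| ≤ B := fun x => by rw [← Real.norm_eq_abs]; exact hB x
      have hFi : Integrable F μT := hF.continuous.integrable_of_hasCompactSupport hFc
      have hlimF := tendsto_integral_mul_of_tendsto_integral_sq (q := fun δ x => (exp (φ δ x) - 1) / δ)
        hFm hFB hg₀ hq' hlim
      refine hlimF.congr' ?_
      filter_upwards [hev, hevT] with δ hδ hδT
      obtain ⟨hi, hz1, htilt⟩ := hrep δ hδ.2 hδT.1 hδT.2
      have hFei : Integrable (fun x => F x * exp (φ δ x)) μT :=
        hi.bdd_mul hFm (ae_of_all _ fun x => hB x)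
      have hint : ∫ x, F x ∂(μ N (T + δ / 2) (T - δ / 2)) = ∫ x, F x * exp (φ δ x) ∂μT := by
        rw [htilt, integral_tilted]
        refine integral_congr_ae (ae_of_all _ fun x => ?_)
        simp only [hz1, div_one, smul_eq_mul]
        ring
      rw [hint, ← integral_sub hFei hFi, ← integral_div]
      refine integral_congr_ae (ae_of_all _ fun x => ?_)
      show F x * ((exp (φ δ x) - 1) / δ) = (F x * exp (φ δ x) - F x) / δ
      ring
  -- the threshold: `½ ∫ (h − h∘Θ)² dμ_{N,T,T} = D/2`
  have hDK : D / 2 < K := by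
    have haeΘ : (fun x : PhaseSpace N => h (x.1, -x.2)) =ᵐ[μT] fun x => g₀ (x.1, -x.2) :=
      hmp.quasiMeasurePreserving.ae_eq_comp hae
    have hint : ∫ x, (h x - h (x.1, -x.2)) ^ 2 ∂(μ N T T) = D := by
      rw [hG, hD]
      refine integral_congr_ae ?_
      filter_upwards [hae, haeΘ] with x hx hxΘ
      rw [hx, hxΘ]
    rw [hint] at hK
    linarith
  filter_upwards [hseam K hDK, hev, hevT] with δ hs hδ hδT
  rw [(hrep δ hδ.2 hδT.1 hδT.2).2.2]
  exact hs

/-! ## 3. The junctions of record with A2 graded -/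

/-- **`K_fix ⟸ A0 ∧ A2ₚ ∧ A3 ∧ A4`** (`p > 1`; A1 discharged by the landed `nessExpMomentBound_holds`).
[folklore] -/
theorem snapshotKLUpperExpansion_of_atoms_moment₄ {p : ℝ} (hp : 1 < p) (h0 : NessGibbsReweighting)
    (h2 : NessOddLogRatioMoment p) (h3 : NessDensityFloor) (h4 : NessLinearResponseL2) :
    SnapshotKLUpperExpansion :=
  snapshotKLUpperExpansion_of_atoms_moment hp h0 nessExpMomentBound_holds h2 h3 h4

/-- ★ **THE JUNCTION OF RECORD, GRADED: `K_fix ⟸ A0 ∧ A2ₚ ∧ S3 ∧ A3p ∧ A4`** for every `p > 1`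
(A3 from the landed seams `A3 ⟸ A3i ∧ A3p`, `A3i ⟸ S3`; compare `snapshotKLUpperExpansion_of_atoms₅K`,
whose A2 is the `p = ∞` rung). [folklore] -/
theorem snapshotKLUpperExpansion_of_atoms_moment₅K {p : ℝ} (hp : 1 < p) (h0 : NessGibbsReweighting)
    (h2 : NessOddLogRatioMoment p) (h3 : KernelTemperatureLipschitz) (h3p : NessFloorMeanValue)
    (h4 : NessLinearResponseL2) : SnapshotKLUpperExpansion :=
  snapshotKLUpperExpansion_of_atoms_moment hp h0 nessExpMomentBound_holds h2
    (nessDensityFloor_of_weightedL1Response_of_floorMeanValue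
      (nessWeightedL1Response_of_kernelTemperatureLipschitz h3) h3p) h4

end Summit.AtomisticToContinuum.FouriersLaw.Theorems.ExtensiveSnapshotIrreversibility.EnergyWindow

end
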